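/-
Origin: expansion seat `planner-pub-hodgecm-toy-0`, handover #2 2026-08-18T04:13:45Z (`HOME/pub-hodgecm-toy/lean/Toy/Exterior.lean`, md5 6545184d, 108 lines);
landed by the gen-5 packager in gate run 21 as `HodgeCM/Model/Toy/Exterior.lean` (verbatim).
-/
-- HANDOVER (planner-pub-hodgecm-toy-0, unit pub-hodgecm-toy): WIP module `Toy.Exterior`; intended final module
-- `HodgeCM.Model.Toy.Exterior` (kind L5, toy model / consistency witness); rename `import Toy.X` ↦ the final prefix.
/-
Copyright: pub-hodgecm cell (HodgeCMPerL). Consistency-witness layer (part (e), referee A G4).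

# Exterior powers: the wedge product and small lemmas

Generic facts about Mathlib's `⋀[R]^n M` used by the toy model: the wedge product as a bilinear map
between fixed degrees, compatibility of `exteriorPower.map` with products, degree-one elements,
graded commutativity in degree one, and the four-fold span of `⋀⁴`.
-/
import Mathlib

/-! PORT of `HodgeCM/Model/Toy/Exterior.lean` (HodgeCMPerL run 81) — verbatim mechanical port; provenance in the PORT header line. -/

namespace HodgeCM.Toy

open exteriorPower

noncomputable section

variable (R : Type*) [CommRing R] (M : Type*) [AddCommGroup M] [Module R M]
variable {N : Type*} [AddCommGroup N] [Module R N]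

/-- The wedge product `⋀^i M × ⋀^j M → ⋀^{i+j} M` (multiplication in the exterior algebra). -/
def wedge (i j : ℕ) : (⋀[R]^i M) →ₗ[R] (⋀[R]^j M) →ₗ[R] (⋀[R]^(i + j) M) :=
  LinearMap.mk₂ R (fun x y => ⟨(x : ExteriorAlgebra R M) * y, SetLike.mul_mem_graded x.2 y.2⟩)
    (fun x x' y => by ext; simp [add_mul])
    (fun c x y => by ext; simp)
    (fun x y y' => by ext; simp [mul_add])
    (fun c x y => by ext; simp)

variable {R M}

/-- (Ported verbatim from the HodgeCMPerL package; no docstring in the source.) -/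
@[simp] lemma wedge_coe (i j : ℕ) (x : ⋀[R]^i M) (y : ⋀[R]^j M) :
    ((wedge R M i j x y : ⋀[R]^(i + j) M) : ExteriorAlgebra R M) = (x : ExteriorAlgebra R M) * y := rfl

/-- `exteriorPower.map` is the restriction of `ExteriorAlgebra.map`. -/
lemma coe_map (n : ℕ) (f : M →ₗ[R] N) (x : ⋀[R]^n M) :
    ((map n f x : ⋀[R]^n N) : ExteriorAlgebra R N) = ExteriorAlgebra.map f (x : ExteriorAlgebra R M) := by
  have : (⋀[R]^n N).subtype ∘ₗ map n f
      = (ExteriorAlgebra.map f).toLinearMap ∘ₗ (⋀[R]^n M).subtype := by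
    apply linearMap_ext
    ext m
    simp [ExteriorAlgebra.map_apply_ιMulti]
  exact congrArg (fun g => g x) this

/-- `f^*(x ∧ y) = f^* x ∧ f^* y`. -/
lemma map_wedge (i j : ℕ) (f : M →ₗ[R] N) (x : ⋀[R]^i M) (y : ⋀[R]^j M) :
    map (i + j) f (wedge R M i j x y) = wedge R N i j (map i f x) (map j f y) := by
  apply Subtype.ext
  simp [coe_map, map_mul]

/-- A degree-one element is `ι` of its image under `oneEquiv`. -/
lemma coe_eq_ι_oneEquiv (x : ⋀[R]^1 M) :
    (x : ExteriorAlgebra R M) = ExteriorAlgebra.ι R (oneEquiv R M x) := by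
  conv_lhs => rw [← (oneEquiv R M).symm_apply_apply x]
  rw [oneEquiv_symm_apply]
  simp

/-- `map 1 f` is `f` transported along `oneEquiv`. -/
lemma map_one_eq (f : M →ₗ[R] N) :
    map 1 f = (oneEquiv R N).symm.toLinearMap ∘ₗ f ∘ₗ (oneEquiv R M).toLinearMap := by
  have h := oneEquiv_naturality f
  rw [← h]
  ext x
  simp

/-- Graded commutativity in degree one. -/
lemma wedge_comm_one (a b : ⋀[R]^1 M) : wedge R M 1 1 a b = -(wedge R M 1 1 b a) := by
  apply Subtype.ext
  rw [Submodule.coe_neg]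
  simp only [wedge_coe, coe_eq_ι_oneEquiv]
  exact eq_neg_of_add_eq_zero_left (ExteriorAlgebra.ι_add_mul_swap _ _)

/-- The interchange law `(a ∧ b) ∧ (c ∧ d) = -((a ∧ c) ∧ (b ∧ d))` in degree one. -/
lemma wedge_interchange (a b c d : ⋀[R]^1 M) :
    wedge R M 2 2 (wedge R M 1 1 a b) (wedge R M 1 1 c d)
      = -(wedge R M 2 2 (wedge R M 1 1 a c) (wedge R M 1 1 b d)) := by
  apply Subtype.ext
  rw [Submodule.coe_neg]
  simp only [wedge_coe, coe_eq_ι_oneEquiv]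
  set x := ExteriorAlgebra.ι R (oneEquiv R M a)
  set y := ExteriorAlgebra.ι R (oneEquiv R M b)
  set z := ExteriorAlgebra.ι R (oneEquiv R M c)
  set w := ExteriorAlgebra.ι R (oneEquiv R M d)
  have h : y * z = -(z * y) := eq_neg_of_add_eq_zero_left (ExteriorAlgebra.ι_add_mul_swap _ _)
  calc x * y * (z * w) = x * (y * z) * w := by simp [mul_assoc]
    _ = -(x * (z * y) * w) := by rw [h]; simp
    _ = -(x * z * (y * w)) := by simp [mul_assoc]

/-- `⋀⁴ M` is spanned by the classes `(a ∧ b) ∧ (c ∧ d)` of degree-one elements. -/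
lemma span_wedge4_eq_top :
    Submodule.span R {x : ⋀[R]^4 M | ∃ a b c d : ⋀[R]^1 M,
      x = wedge R M 2 2 (wedge R M 1 1 a b) (wedge R M 1 1 c d)} = ⊤ := by
  apply top_le_iff.mp
  rw [← exteriorPower.ιMulti_span (R := R) (n := 4) (M := M)]
  apply Submodule.span_le.mpr
  rintro _ ⟨v, rfl⟩
  apply Submodule.subset_span
  refine ⟨(oneEquiv R M).symm (v 0), (oneEquiv R M).symm (v 1), (oneEquiv R M).symm (v 2),
    (oneEquiv R M).symm (v 3), ?_⟩
  apply Subtype.ext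
  simp only [wedge_coe, coe_eq_ι_oneEquiv, LinearEquiv.apply_symm_apply, ιMulti_apply_coe]
  rw [ExteriorAlgebra.ιMulti_apply]
  simp [List.ofFn_succ, mul_assoc]

end

end HodgeCM.Toy
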